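import Summits.QuantumFields.YangMills.Theorems.LuscherReductionTwistedTraceScalingBOStiffFlatBridge
import HarnessLib

/-!
# The C4-CORE record WITH ITS PROFILE RADIUS EXPOSED: `∃ A : RecordAnalyticInput L s M, supp (A.Ω β) ⊆ {‖x‖ ≤ β^{-1/2}·btLog β}` (`L ≥ 2`, `1/6 < s < 1/4`)
# (lane A of S-BASE, crux `TwistedTraceScaling` stmt-QuantumFields-20203, line «twolattice», stub `stub_fixedLatticeTraceLaw`; C4-SHELL; lead g23; card `pub/ym-fleet/ym-luscher-20007-p1/Lines-shell-gain.md`)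

The record `RecordAnalyticInput L s M` (✓`…BOStiffFlatBridge.recordAnalyticInput`) abstracts the fibre profile's support radius `r` and only remembers `12|Site|·r β < β^{-s}` (`hr_small`).
The C4-SHELL's INNER SHADOW (`ShellBricks.hshadowIn`, ✓`…ShellAssembly`) needs the true radius `r_B β = min(1/40, β^{-1/2}ℓ)` of the cap-restricted frozen profile, which is polynomially
below every shell radius `β^{-a}`, `a < 1/2`.  This file re-runs the three closing wrappers of the record VERBATIM with the radius kept in the conclusion:
* `recordAnalyticInput_of_profile_r` (twin of ✓`recordAnalyticInput_of_profile`), `recordAnalyticInput_of_hST_r` (twin of ✓`recordAnalyticInput_of_hST`),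
  `recordAnalyticInput_of_specs_r` (twin of ✓`recordAnalyticInput_of_specs`);
* ★★★ `recordAnalyticInput_r (hLz) (hL2) (hs6 : 1/6 < s) (hs4 : s < 1/4) : ∃ M₀ ≥ 2, ∀ M ≥ M₀, ∃ A : RecordAnalyticInput L s M, ∀ β x, A.Ω β x ≠ 0 → ‖x‖ ≤ β^{-1/2}·btLog β`
  (fed, as ✓`recordAnalyticInput`, with ✓`spec_S3` and ✓`spec_gap_inputs_of_hflat` ∘ ✓`hflat_record`).
HONEST FRAMING: bookkeeping (no new analysis) for a stub of a child of the CONDITIONAL reduction route R2b1; C4-SHELL, COARSE-UPPER/LOWER/TAIL, the stubs and the crux stay OPEN; not infinite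
volume, not a mass gap, not Clay.  No definitions, no `sorry`.
-/

set_option autoImplicit false

noncomputable section

open MeasureTheory Filter Topology Real Asymptotics
open scoped BigOperators
open Literature.MathematicalPhysics.QuantumFieldTheory
open Literature.MathematicalPhysics.QuantumLattice

namespace Summit.QuantumFields.YangMills.Theorems.FemtoTransferGap.TwoLattice.ConstTube

open Summit.QuantumFields.YangMills.Theorems.FemtoTransferGap
open Summit.QuantumFields.YangMills.Theorems.FemtoTransferGap.TwoLattice
open Summit.QuantumFields.YangMills.Theorems.FemtoTransferGap.TwoLattice.Avg
open Summit.QuantumFields.YangMills.Theorems.FemtoTransferGap.TwoLattice.Stiff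
open Summit.QuantumFields.YangMills.Theorems.FemtoTransferGap.TwoLattice.GnChart
open Summit.QuantumFields.YangMills.Theorems.FemtoTransferGap.TwoLattice.Cov

variable {L : ℕ} [NeZero L]

/-! ## §1 The profile wrapper with the radius kept -/

/-- ★ Twin of ✓`recordAnalyticInput_of_profile` keeping the profile radius in the conclusion. [cite: Luscher1983, §3] [cite: SjostrandZworski2007, §2] -/
theorem recordAnalyticInput_of_profile_r {s M : ℝ} (hs6 : 1 / 6 < s) (hs4 : s ≤ 1 / 4) {Ω : ℝ → LinkSpace L → ℝ} (hΩm : ∀ β, Measurable (Ω β))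
    (hΩ1 : ∀ β x, |Ω β x| ≤ 1) (hΩ0 : ∀ β x, 0 ≤ Ω β x) (hΩinv : ∀ β (g : SU2) (x : LinkSpace L), Ω β (adL L g x) = Ω β x)
    (hΩr : ∀ β x, Ω β x ≠ 0 → ‖x‖ ≤ min (1 / 40) (powScale (1 / 2) β * btLog β))
    (hI : ∀ β, 0 < ∫ v, Ω β (linkEmbed L v) ∂orthoTransverse L) (hγ : ∀ β, 0 < recordGamma L Ω β)
    {b : ℝ → ℝ} {θ₀ : ℝ} (hb : ∀ β, 0 ≤ b β) (hb_small : ∀ a : ℝ, 0 < a → ∀ᶠ β in atTop, b β ^ 2 ≤ a * bareLambda ((L : ℝ) ^ 3 * β)) (hθ₀ : 0 < θ₀ ∧ θ₀ ≤ 1)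
    (hST : ∀ᶠ β in atTop, ∀ v : GaugeConfig 3 L SU2 → ℝ, Measurable v → (∃ C : ℝ, ∀ U, |v U| ≤ C) → (∀ U, v U ≠ 0 → recordChi L s 43 M β U ≠ 0) →
      (∀ u, fibreInner L (softWeight (recordChi L s 43 M β)) (Ω β) v u = 0) →
      tubeForm β v ≤ (1 - θ₀) * ((btC L β (Ω β) (btEps β) (5 * (powScale (1 / 2) β * btLog β ^ 2)) / fpZ (btEps β) / recordGamma L Ω β) *
        levelValue su2Rep 1 ((L : ℝ) ^ 3 * β) 0) * tubeNormSq (softWeight (recordChi L s 43 M β)) v)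
    (hOD : ∀ᶠ β in atTop, ∀ (φ : GaugeConfig 3 1 SU2 → ℝ) (v : GaugeConfig 3 L SU2 → ℝ), Measurable φ → (∃ C : ℝ, ∀ u, |φ u| ≤ C) →
      (∀ u, φ u ≠ 0 → orbitDist u < recordDelta1 L s β) → Measurable v → (∃ C : ℝ, ∀ U, |v U| ≤ C) → (∀ U, v U ≠ 0 → recordChi L s 43 M β U ≠ 0) →
      (∀ u, fibreInner L (softWeight (recordChi L s 43 M β)) (Ω β) v u = 0) →
      |tubeCross β (boFun L φ (Ω β)) v| ≤ b β * ((btC L β (Ω β) (btEps β) (5 * (powScale (1 / 2) β * btLog β ^ 2)) / fpZ (btEps β) / recordGamma L Ω β) *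
          levelValue su2Rep 1 ((L : ℝ) ^ 3 * β) 0) *
          Real.sqrt (tubeNormSq (softWeight (recordChi L s 43 M β)) (boFun L φ (Ω β))) * Real.sqrt (tubeNormSq (softWeight (recordChi L s 43 M β)) v) ∧
      |tubeCross β v (boFun L φ (Ω β))| ≤ b β * ((btC L β (Ω β) (btEps β) (5 * (powScale (1 / 2) β * btLog β ^ 2)) / fpZ (btEps β) / recordGamma L Ω β) *
          levelValue su2Rep 1 ((L : ℝ) ^ 3 * β) 0) *
          Real.sqrt (tubeNormSq (softWeight (recordChi L s 43 M β)) (boFun L φ (Ω β))) * Real.sqrt (tubeNormSq (softWeight (recordChi L s 43 M β)) v)) :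
    ∃ A : RecordAnalyticInput L s M, ∀ β x, A.Ω β x ≠ 0 → ‖x‖ ≤ powScale (1 / 2) β * btLog β := by
  have hs0 : 0 < s := by linarith
  have hs2 : s < 1 / 2 := by linarith
  set r : ℝ → ℝ := fun β => min (1 / 40) (powScale (1 / 2) β * btLog β) with hrdef
  have hr : ∀ β, 0 < r β ∧ r β ≤ 1 / 40 ∧ r β ≤ powScale (1 / 2) β * btLog β := fun β =>
    ⟨lt_min (by norm_num) (mul_pos (powScale_pos _ _) (lt_of_lt_of_le one_pos (one_le_btLog β))), min_le_left _ _, min_le_right _ _⟩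
  have hr' : ∀ β, 0 ≤ r β ∧ r β ≤ powScale (1 / 2) β * btLog β := fun β => ⟨(hr β).1.le, (hr β).2.2⟩
  have hΩt : ∀ β (v : Edge 3 L → Fin 3 → ℝ), Ω β (linkEmbed L v) ≠ 0 → (∀ (e : Edge 3 L) (c : Fin 3), |v e c| ≤ r β) ∧ ‖linkEmbed L v‖ ≤ r β := by
    intro β v hv
    have h := hΩr β _ hv
    exact ⟨fun e c => by have := Summit.QuantumFields.YangMills.Theorems.FemtoTransferGap.TwoLattice.Cov.abs_apply_le_norm (linkEmbed L v) e c; rw [linkEmbed_apply] at this; exact this.trans h, h⟩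
  set σf : ℝ → ℝ := fun β => btC L β (Ω β) (btEps β) (5 * (powScale (1 / 2) β * btLog β ^ 2)) / fpZ (btEps β) / recordGamma L Ω β with hσfdef
  have hσfpos : ∀ β, 0 ≤ β → 0 < σf β := fun β hβ => by
    rw [hσfdef]; dsimp only
    have hρR : 2 * (btEps β / 3) < 5 * (powScale (1 / 2) β * btLog β ^ 2) := by
      have hεx : btEps β ≤ powScale (1 / 2) β := powScale_le_powScale (by norm_num) β
      have hx0 := powScale_pos (1 / 2) β
      have h1 : powScale (1 / 2) β * 1 ≤ powScale (1 / 2) β * btLog β ^ 2 := mul_le_mul_of_nonneg_left (one_le_pow₀ (one_le_btLog β)) hx0.le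
      linarith
    exact div_pos (div_pos (btC_profile_pos hβ (hΩm β) (hΩ1 β) (hΩ0 β) (by linarith [(hr β).2.1]) (hΩt β) (hI β) hρR) (fpZ_pos (btEps_pos_le β).1)) (hγ β)
  set σ : ℝ → ℝ := fun β => if 0 < σf β then σf β else 1 with hσdef
  have hσpos : ∀ β, 0 < σ β := fun β => by
    rw [hσdef]; dsimp only
    split_ifs with h
    · exact h
    · exact one_pos
  have hσeq : ∀ᶠ β : ℝ in atTop, σ β = σf β :=
    (eventually_ge_atTop (0 : ℝ)).mono fun β hβ => by rw [hσdef]; dsimp only; rw [if_pos (hσfpos β hβ)]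
  refine ⟨
    { Ω := Ω, r := r, σ := σ, κ := fun β => 2 * (powScale (2 * s) β * btLog β ^ 9), b := b, θ₀ := θ₀,
      hΩm := hΩm, hΩ1 := hΩ1, hΩinv := hΩinv, hΩr := hΩr, hr := fun β => ⟨(hr β).1.le, by linarith [(hr β).2.1]⟩,
      hr_small := eventually_radius_small_B hs2 hr', hγ := hγ,
      hσ := hσpos, hκ0 := rateB_nonneg s, hκ_dom := rateB_dom s, hκ_small := rateB_small (L := L) hs6, hb := hb, hb_small := hb_small, hθ₀ := hθ₀,
      hT := ?_, hST := ?_, hOD := ?_ }, fun β x hx => (hΩr β x hx).trans (min_le_right _ _)⟩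
  · filter_upwards [profileB_hT (L := L) hs0 hs4 hΩm hΩ1 hΩ0 hΩinv hr hΩt hγ, hσeq] with β h he
    rw [he]
    exact h
  · filter_upwards [hST, hσeq] with β h he
    rw [he]
    exact h
  · filter_upwards [hOD, hσeq] with β h he
    rw [he]
    exact h

/-! ## §2 The (B-ST) wrapper with the radius kept -/

set_option maxHeartbeats 1600000 in
-- large record expressions.
/-- ★ Twin of ✓`recordAnalyticInput_of_hST` keeping the profile radius in the conclusion. [cite: Luscher1983, §3] [cite: SjostrandZworski2007, §2] -/
theorem recordAnalyticInput_of_hST_r (hLz : Nonempty (NzSite L)) (hL2 : 2 ≤ L) {s : ℝ} (hs6 : 1 / 6 < s) (hs4 : s < 1 / 4) :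
    ∃ M₀ : ℝ, 2 ≤ M₀ ∧ ∀ M : ℝ, M₀ ≤ M → ∀ θ₀ : ℝ, (0 < θ₀ ∧ θ₀ ≤ 1) →
      (∀ᶠ β : ℝ in atTop, ∀ v : GaugeConfig 3 L SU2 → ℝ, Measurable v → (∃ C : ℝ, ∀ U, |v U| ≤ C) → (∀ U, v U ≠ 0 → (recordChi L s 43 M β) U ≠ 0) → (∀ u, fibreInner L (softWeight (recordChi L s 43 M β)) (fun x : LinkSpace L => {x : LinkSpace L | linkCurry x ∈ capBalancedSet L}.indicator (fun _ => (1 : ℝ)) x * frozenProfile L (fun β' => stiffGaussExp L (β' / 2) β') (fun β' => min (1 / 40) (powScale (1 / 2) β' * btLog β')) β x) v u = 0) → tubeForm β v ≤ (1 - θ₀) * ((btC L β (fun x : LinkSpace L => {x : LinkSpace L | linkCurry x ∈ capBalancedSet L}.indicator (fun _ => (1 : ℝ)) x * frozenProfile L (fun β' => stiffGaussExp L (β' / 2) β') (fun β' => min (1 / 40) (powScale (1 / 2) β' * btLog β')) β x) (btEps β) (5 * (powScale (1 / 2) β * btLog β ^ 2)) / fpZ (btEps β) / recordGamma L (fun β'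 => fun x : LinkSpace L => {x : LinkSpace L | linkCurry x ∈ capBalancedSet L}.indicator (fun _ => (1 : ℝ)) x * frozenProfile L (fun β'' => stiffGaussExp L (β'' / 2) β'') (fun β'' => min (1 / 40) (powScale (1 / 2) β'' * btLog β'')) β' x) β) * levelValue su2Rep 1 ((L : ℝ) ^ 3 * β) 0) * tubeNormSq (softWeight (recordChi L s 43 M β)) v) → ∃ A : RecordAnalyticInput L s M, ∀ β x, A.Ω β x ≠ 0 → ‖x‖ ≤ powScale (1 / 2) β * btLog β := by
  obtain ⟨M₀, hM₀, H⟩ := hOD_record (L := L) hLz hL2 hs6 hs4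
  refine ⟨M₀, hM₀, fun M hM θ₀ hθ₀ hST => ?_⟩
  obtain ⟨b, hb, hbs, hOD⟩ := H M hM
  -- the structural fields of the cap-restricted frozen profile
  have hqfm : ∀ β', Measurable ((fun β' => stiffGaussExp L (β' / 2) β') β') := fun β' => measurable_stiffGaussExp _ _
  have hqf0 : ∀ β' x, 0 ≤ (fun β' => stiffGaussExp L (β' / 2) β') β' x := fun β' x => stiffGaussExp_nonneg _ _ x
  have hqinv : ∀ β' (g : SU2) (x : LinkSpace L), (fun β' => stiffGaussExp L (β' / 2) β') β' (adL L g x) = (fun β' => stiffGaussExp L (β' / 2) β') β' x := fun β' g x => stiffGaussExp_adL _ _ g x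
  have hr : ∀ β', 0 < (fun β' => min (1 / 40) (powScale (1 / 2) β' * btLog β')) β' := fun β' => lt_min (by norm_num) (mul_pos (powScale_pos _ _) (lt_of_lt_of_le one_pos (one_le_btLog β')))
  obtain ⟨hFm, hF1, hFinv, hFr, hFγ⟩ := frozenProfile_fields (L := L) hqfm hqf0 hqinv hr
  have hF0 : ∀ β' x, 0 ≤ frozenProfile L (fun β' => stiffGaussExp L (β' / 2) β') (fun β' => min (1 / 40) (powScale (1 / 2) β' * btLog β')) β' x := fun β' x => (frozenProfile_mem_Icc hqf0 _ β' x).1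
  have hΩm : ∀ β', Measurable ((fun β' => fun x : LinkSpace L => {x : LinkSpace L | linkCurry x ∈ capBalancedSet L}.indicator (fun _ => (1 : ℝ)) x * frozenProfile L (fun β'' => stiffGaussExp L (β'' / 2) β'') (fun β'' => min (1 / 40) (powScale (1 / 2) β'' * btLog β'')) β' x) β') := fun β' => measurable_capRestrict (L := L) (hFm β')
  have hΩdat : ∀ β' x, 0 ≤ (fun β' => fun x : LinkSpace L => {x : LinkSpace L | linkCurry x ∈ capBalancedSet L}.indicator (fun _ => (1 : ℝ)) x * frozenProfile L (fun β'' => stiffGaussExp L (β'' / 2) β'') (fun β'' => min (1 / 40) (powScale (1 / 2) β'' * btLog β'')) β' x) β' x ∧ (fun β' => fun x : LinkSpace L => {x : LinkSpace L | linkCurry x ∈ capBalancedSet L}.indicator (fun _ => (1 : ℝ)) x * frozenProfile L (fun β'' => stiffGaussExp L (β'' / 2) β'') (fun β'' => min (1 / 40) (powScale (1 / 2) β'' * btLog β'')) β' x) β' x ≤ frozenProfile L (fun β' => stiffGaussExp L (β' / 2) β') (fun β' => min (1 / 40) (powScale (1 / 2) β' * btLog β')) β' x ∧ |(fun β' =>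 fun x : LinkSpace L => {x : LinkSpace L | linkCurry x ∈ capBalancedSet L}.indicator (fun _ => (1 : ℝ)) x * frozenProfile L (fun β'' => stiffGaussExp L (β'' / 2) β'') (fun β'' => min (1 / 40) (powScale (1 / 2) β'' * btLog β'')) β' x) β' x| ≤ 1 :=
    fun β' x => capRestrict_mem (L := L) (hF0 β') (hF1 β') x
  have hΩ1 : ∀ β' x, |(fun β' => fun x : LinkSpace L => {x : LinkSpace L | linkCurry x ∈ capBalancedSet L}.indicator (fun _ => (1 : ℝ)) x * frozenProfile L (fun β'' => stiffGaussExp L (β'' / 2) β'') (fun β'' => min (1 / 40) (powScale (1 / 2) β'' * btLog β'')) β' x) β' x| ≤ 1 := fun β' x => (hΩdat β' x).2.2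
  have hΩ0 : ∀ β' x, 0 ≤ (fun β' => fun x : LinkSpace L => {x : LinkSpace L | linkCurry x ∈ capBalancedSet L}.indicator (fun _ => (1 : ℝ)) x * frozenProfile L (fun β'' => stiffGaussExp L (β'' / 2) β'') (fun β'' => min (1 / 40) (powScale (1 / 2) β'' * btLog β'')) β' x) β' x := fun β' x => (hΩdat β' x).1
  have hΩinv : ∀ β' (g : SU2) (x : LinkSpace L), (fun β' => fun x : LinkSpace L => {x : LinkSpace L | linkCurry x ∈ capBalancedSet L}.indicator (fun _ => (1 : ℝ)) x * frozenProfile L (fun β'' => stiffGaussExp L (β'' / 2) β'') (fun β'' => min (1 / 40) (powScale (1 / 2) β'' * btLog β'')) β' x) β' (adL L g x) = (fun β' => fun x : LinkSpace L => {x : LinkSpace L | linkCurry x ∈ capBalancedSet L}.indicator (fun _ => (1 : ℝ)) x * frozenProfile L (fun β'' => stiffGaussExp L (β'' / 2) β'') (fun β'' => min (1 / 40) (powScale (1 / 2) β'' * btLog β'')) β' x) β' x := fun β' g x => capRestrict_adL (L := L) (fun g' x' => hFinv β' g' x') g x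
  have hΩr : ∀ β' x, (fun β' => fun x : LinkSpace L => {x : LinkSpace L | linkCurry x ∈ capBalancedSet L}.indicator (fun _ => (1 : ℝ)) x * frozenProfile L (fun β'' => stiffGaussExp L (β'' / 2) β'') (fun β'' => min (1 / 40) (powScale (1 / 2) β'' * btLog β'')) β' x) β' x ≠ 0 → ‖x‖ ≤ (fun β' => min (1 / 40) (powScale (1 / 2) β' * btLog β')) β' := fun β' x hx => hFr β' x (right_ne_zero_of_mul hx)
  have hI : ∀ β', 0 < ∫ v, (fun β' => fun x : LinkSpace L => {x : LinkSpace L | linkCurry x ∈ capBalancedSet L}.indicator (fun _ => (1 : ℝ)) x * frozenProfile L (fun β'' => stiffGaussExp L (β'' / 2) β'') (fun β'' => min (1 / 40) (powScale (1 / 2) β'' * btLog β'')) β' x) β' (linkEmbed L v) ∂orthoTransverse L := fun β' => by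
    have e := integral_capRestrict_linkEmbed (L := L) (frozenProfile L (fun β' => stiffGaussExp L (β' / 2) β') (fun β' => min (1 / 40) (powScale (1 / 2) β' * btLog β')) β')
    have h := integral_profile_pos (L := L) (hFm β') (hF1 β') (hF0 β') (hr β') (fun x hx => frozenProfile_ne_zero_of_norm_lt _ _ β' hx)
    simp only at e ⊢
    rw [e]; exact h
  have hγ : ∀ β', 0 < recordGamma L (fun β' => fun x : LinkSpace L => {x : LinkSpace L | linkCurry x ∈ capBalancedSet L}.indicator (fun _ => (1 : ℝ)) x * frozenProfile L (fun β'' => stiffGaussExp L (β'' / 2) β'') (fun β'' => min (1 / 40) (powScale (1 / 2) β'' * btLog β'')) β' x) β' := fun β' => by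
    rw [recordGamma_capRestrict (L := L)]; exact hFγ β'
  exact recordAnalyticInput_of_profile_r (L := L) (Ω := (fun β' => fun x : LinkSpace L => {x : LinkSpace L | linkCurry x ∈ capBalancedSet L}.indicator (fun _ => (1 : ℝ)) x * frozenProfile L (fun β'' => stiffGaussExp L (β'' / 2) β'') (fun β'' => min (1 / 40) (powScale (1 / 2) β'' * btLog β'')) β' x)) hs6 hs4.le hΩm hΩ1 hΩ0 hΩinv hΩr hI hγ hb hbs hθ₀ hST hOD

/-! ## §3 The record with the radius kept -/

/-- ★ Twin of ✓`recordAnalyticInput_of_specs` keeping the profile radius in the conclusion. Original: **`RecordAnalyticInput` FROM THE TWO FIBRE-BLOCK SPECS**: for `1/6 < s < 1/4` (and `NzSite L` nonempty, `L ≥ 2`), assuming the conclusions of `spec_S3` and `spec_gap_inputs`,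
`∃ M₀ ≥ 2, ∀ M ≥ M₀, Nonempty (RecordAnalyticInput L s M)` — ✓`recordAnalyticInput_of_hST` ∘ `hST_record_of_specs`. [cite: Luscher1983, §3] [cite: SjostrandZworski2007, §2] -/
theorem recordAnalyticInput_of_specs_r (hLz : Nonempty (NzSite L)) (hL2 : 2 ≤ L) {s : ℝ} (hs6 : 1 / 6 < s) (hs4 : s < 1 / 4)
    (hS3 : ∃ M₀ : ℝ, 2 ≤ M₀ ∧ ∀ M : ℝ, M₀ ≤ M → ∀ η : ℝ, 0 < η → ∀ η₂ : ℝ, 0 < η₂ → ∀ᶠ β : ℝ in atTop,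
      (∀ x ∈ cS L β, ∫ y, cM L β x y * cΘ L β y ∂orthoTransverse L ≤ (1 + η) * cΛ L s M β * (cΘ L β x * cW L s M β x)) ∧
      (∫ x in cS L β, ((∫ y, cM L β x y * cΘ L β y ∂orthoTransverse L) - cΛ L s M β * (cΘ L β x * cW L s M β x)) ^ 2 / cW L s M β x ∂orthoTransverse L ≤
        (η₂ * cΛ L s M β) ^ 2 * ∫ x, cΘ L β x ^ 2 * cW L s M β x ∂orthoTransverse L))
    (hGI : ∃ M₀ : ℝ, 2 ≤ M₀ ∧ ∀ M : ℝ, M₀ ≤ M → ∃ P₀ Cν C'ν cJ : ℝ, 0 < P₀ ∧ 0 < Cν ∧ 0 < C'ν ∧ 0 < cJ ∧ cJ / (Cν * P₀) ≤ 1 ∧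
      ∀ δ : ℝ, 0 < δ → ∀ᶠ β : ℝ in atTop, ∃ (D : (Edge 3 L → Fin 3 → ℝ) → ℝ) (J₀ : (Edge 3 L → Fin 3 → ℝ) → (Edge 3 L → Fin 3 → ℝ) → ℝ) (θ₀ CD CJ : ℝ),
        Measurable D ∧ (∀ x, |D x| ≤ CD) ∧ Measurable (Function.uncurry J₀) ∧ (∀ x y, |J₀ x y| ≤ CJ) ∧ 0 < θ₀ ∧ (∀ x ∈ cS L β, θ₀ ≤ cΘ L β x) ∧
        0 < ∫ x in cS L β, D x ∂orthoTransverse L ∧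
        (∀ x ∈ cS L β, cΘ L β x ^ 2 * cW L s M β x ≤ Cν * D x) ∧ (∀ x ∈ cS L β, D x ≤ C'ν * (cΘ L β x ^ 2 * cW L s M β x)) ∧
        (∀ x y, cJ * (cΛ L s M β * J₀ x y) ≤ cΘ L β x * cM L β x y * cΘ L β y) ∧
        (∀ g : (Edge 3 L → Fin 3 → ℝ) → ℝ, Measurable g → (∃ C : ℝ, ∀ x, |g x| ≤ C) → (∀ x, x ∉ cS L β → g x = 0) →
          (∫ x in cS L β, g x ^ 2 * D x ∂orthoTransverse L) - (∫ x in cS L β, g x * D x ∂orthoTransverse L) ^ 2 / (∫ x in cS L β, D x ∂orthoTransverse L) ≤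
            P₀ * ((1 / 2) * ∫ x, ∫ y, (g x - g y) ^ 2 * J₀ x y ∂orthoTransverse L ∂orthoTransverse L) + δ * ∫ x in cS L β, g x ^ 2 * D x ∂orthoTransverse L)) :
    ∃ M₀ : ℝ, 2 ≤ M₀ ∧ ∀ M : ℝ, M₀ ≤ M → ∃ A : RecordAnalyticInput L s M, ∀ β x, A.Ω β x ≠ 0 → ‖x‖ ≤ powScale (1 / 2) β * btLog β := by
  obtain ⟨M₁, hM₁, H1⟩ := recordAnalyticInput_of_hST_r (L := L) hLz hL2 hs6 hs4
  obtain ⟨M₂, hM₂, H2⟩ := hST_record_of_specs (L := L) hLz hL2 hs6 hs4 hS3 hGI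
  refine ⟨max M₁ M₂, le_trans hM₁ (le_max_left _ _), fun M hM => ?_⟩
  obtain ⟨θ₀, hθ₀, hST⟩ := H2 M (le_trans (le_max_right _ _) hM)
  exact H1 M (le_trans (le_max_left _ _) hM) θ₀ hθ₀ hST

/-- ★★★ **THE RECORD WITH ITS PROFILE RADIUS**: for `L ≥ 2` with a non-zero site and `1/6 < s < 1/4`, `∃ M₀ ≥ 2, ∀ M ≥ M₀, ∃ A : RecordAnalyticInput L s M` whose fibre profile is supported
in `{‖x‖ ≤ β^{-1/2}·btLog β}` (composition as ✓`recordAnalyticInput`: ✓`spec_S3`, ✓`spec_gap_inputs_of_hflat` ∘ ✓`hflat_record`). [cite: Luscher1983, §3] [cite: SjostrandZworski2007, §2] -/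
theorem recordAnalyticInput_r (hLz : Nonempty (NzSite L)) (hL2 : 2 ≤ L) {s : ℝ} (hs6 : 1 / 6 < s) (hs4 : s < 1 / 4) :
    ∃ M₀ : ℝ, 2 ≤ M₀ ∧ ∀ M : ℝ, M₀ ≤ M → ∃ A : RecordAnalyticInput L s M, ∀ β x, A.Ω β x ≠ 0 → ‖x‖ ≤ powScale (1 / 2) β * btLog β :=
  recordAnalyticInput_of_specs_r (L := L) hLz hL2 hs6 hs4 (spec_S3 (L := L) hLz hL2 hs6 hs4)
    (spec_gap_inputs_of_hflat (L := L) hLz hL2 hs6 hs4 (hflat_record (L := L) hLz hL2 (by linarith) (by linarith)))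

end Summit.QuantumFields.YangMills.Theorems.FemtoTransferGap.TwoLattice.ConstTube

end
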